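import Summits.QuantumFields.YangMills.Theorems.UnitScaleTiltProp8FlatSmallSolution158
import HarnessLib

/-!
# Route `UnitScaleTilt`, crux K1 child «MinimiserStabilityRegPr» (stmt-QuantumFields-19200), leaf V2′ `stub_halvingStep` — PILLAR F4, PART 3:
# **[Balaban1985Variational] Eq. (158) at background 1, AT THE d = 3 CARRIER — (a) REALITY: the small solution takes values in every closed
# invariant value set `S ⊆ 𝔤ᶜ` (e.g. `S = 𝔤 = su(2)`: 𝔤-valued data ⇒ 𝔤-valued `A₁`), and (b) THE (165) ENTRY FOR ARBITRARY LETTERS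
# (second-order sizes `|∂*∂A₁|`, `|ΔA₁|` included): `N(−G̃f) ≤ B_N·sup|f|` for all `f` ⇒ `N(A₁) ≤ B_N·C₄ρ²` for every solution with
# `‖A₁ + HB‖₍₁₁₅₎ ≤ ρ < a₃`**

Cell `ym3-torus` (HUMAN RULING D-0037, YM ladder rung R3), seat `ym-ust-19200-f4` gen 0.  `--supports stmt-QuantumFields-19200 --as helper`;
count-neutral; third file of pillar F4 (after `…FlatSmallSolution158` p520930 = Prop. 6 for (158), `…FlatChart47` = Prop. 3's chart).

THE PRINT ([Balaban1985Variational], CMP **102** (1985); journal page = PDF page + 276).  (a) p. 285/289: the configurations are *«with values in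
the complexified Lie algebra 𝔤ᶜ»* for the analyticity arguments, while the variational problem ((5)–(6), (19)–(21), U₁ = e^{iηA}) is over
𝔤-valued fields — the solution of the real problem is the real fixed point (the successive approximations of p. 286/296 stay real for real
data).  (b) p. 304 (165): *«This bound, the equality (159) and Eq. (158) imply |A|, |∇A|, |∂^{η*}∂^ηA|, |Δ^ηA| < ¼M_Δ max{B₃ε₁, ½ε₀} +
B₀C₄(36dL²B₁Mε₀)² + B₀4C₂(36dL²B₁Mε₀)²»* — the middle term for ALL FOUR sizes is `|A₁|_size ≤ (size-bound of G̃ from |·|₍₋₃₎) × C₄ ×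
‖A₁ + HB‖²₍₁₁₅₎`, read off `A₁ = −G̃((δ/δA′)V)(A₁ + HB)` and (98); the lit desk's L-21 (β): *«the A-PRIORI quadratic bound on A₁ read off (158) =
‖G̃‖ (incl. SECOND derivatives …) × C₄ × |A′|²»*.

WHAT IS PROVED (sorry-free; no definition; axioms standard; every `P : Params`, weight `c > 0`, finite-dimensional complex fibre `V`; then the
d = 3 carrier `P := F.P K`, `c := L^{K−n}`):
* §1 **`letter_solution158_le`** (+ `_T3`) — for ANY real functional `N` on fine fields with `N(−Gf) ≤ B_N·β` whenever `|f| ≤ β` (a «letter»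
  of `G̃`: sup, weighted gradient, `|∂*∂·|`, `|Δ·|`, a Hölder quotient, … — pillar F3's `FlatPropagatorGrad.grad_lap_GE_le_of_ineq110` shape)
  and `W` with Prop. 4's (98) pointwise: every solution of `A₁ + G(W(A₁ + 𝔄)) = 0` with `‖A₁ + 𝔄‖₍₁₁₅₎ ≤ ρ < a₃` has `N(A₁) ≤ B_N·C₄ρ²`.
* §2 **`smallSolution158_valued`** (+ `_T3`) — under the data of `FlatSmallSolution158.existsUnique_smallSolution158`, for a CLOSED value
  set `S ⊆ V` containing `0` such that `X ↦ −G(W(X + 𝔄))` maps `S`-valued fields of (115)-size `≤ ε₄` to `S`-valued fields, EVERY solution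
  of (158) of (115)-size `≤ ε₄` is `S`-valued.  Mechanism: lit-balaban `B11Prop6Scheme.solution_mem_of_invariant` (Banach iteration inside the
  closed invariant set) at the jet space `B11Eq115Space.JetSup` over `PBond P 0`, the value condition being closed by continuity of evaluation
  (`JetSup.evalCLM`), plus the uniqueness of `existsUnique_smallSolution158`.
HONEST SCOPE.  As parts 1–2: `G̃`, `W`, `𝔄` abstract with their printed bounds as hypotheses; nothing of [2,3]/Prop. 4 proved; (ii) the
invariance of `S` under the data (flat operators act componentwise and are real; `(δ/δA′)V` maps 𝔤-valued to 𝔤-valued) is the USER's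
one-line check at the concrete letters; (iii) NOT a claim about the mass gap.

References: T. Bałaban, CMP **102** (1985) 277–309 [Balaban1985Variational] (115) p.294, Prop. 6 pp.295–296, (158) p.302, (165) p.304.
-/

set_option autoImplicit false

noncomputable section

open Metric Set

namespace Summit.QuantumFields.YangMills.Theorems.FlatSmallSolution158Real

open Literature.MathematicalPhysics.QuantumFieldTheory.Balaban1983to89
open Literature.MathematicalPhysics.QuantumFieldTheory.Balaban1983to89.B11Eq115Space
open Literature.MathematicalPhysics.QuantumFieldTheory.Balaban1983to89.B11Prop6Scheme (mapT mapT_158 solution_mem_of_invariant)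
open Literature.MathematicalPhysics.QuantumFieldTheory.Balaban1983to89.B13Contraction113 (QuadAnalytic)
open Summit.QuantumFields.YangMills.Theorems.FlatSmallSolution158 (exists_diffLin existsUnique_smallSolution158)

section Generic

variable {P : Params} {V : Type*} [NormedAddCommGroup V] [NormedSpace ℂ V]

/-! ## §1 The (165) entry for an arbitrary letter of `G̃` -/

/-- **THE (165) ENTRY FOR AN ARBITRARY LETTER** — p. 304: *«the equality (159) and Eq. (158) imply |A|, |∇A|, |∂^{η*}∂^ηA|, |Δ^ηA| < … +
B₀C₄(36dL²B₁Mε₀)² + …»*: if a real functional `N` on fine fields is bounded on `−G̃f` by `B_N·β` whenever `|f(b)| ≤ β` everywhere (any size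
of the flat operator controlled from the sup norm of the source: `|G̃f|`, `η⁻¹|∇G̃f|`, `|∂*∂G̃f|`, `|ΔG̃f|`, …), and `W = (δ/δA′)V` obeys (98)
pointwise on the (115)-ball of radius `a₃`, then every solution of `A₁ + G(W(A₁ + 𝔄)) = 0` with `‖A₁ + 𝔄‖₍₁₁₅₎ ≤ ρ < a₃` has `N(A₁) ≤ B_N·C₄ρ²`.
No smallness, no uniqueness, no linearity of `N`. [cite: Balaban1985Variational, (165) p.304, (158) p.302, (98) p.293] -/
theorem letter_solution158_le {c : ℝ} (G : (PBond P 0 → V) →ₗ[ℂ] (PBond P 0 → V)) (W : (PBond P 0 → V) → (PBond P 0 → V))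
    {C₄ a₃ ρ : ℝ}
    (hWq : ∀ (Y : PBond P 0 → V) (r : ℝ), r < a₃ → (∀ b, ‖Y b‖ ≤ r) →
      (∀ (s : Site P 0) (μ ν : Fin P.d), c * ‖Y ⟨s.shift ν, μ⟩ - Y ⟨s, μ⟩‖ ≤ r) → ∀ b, ‖W Y b‖ ≤ C₄ * r ^ 2)
    {A₁ 𝔄 : PBond P 0 → V} (hsol : A₁ + G (W (A₁ + 𝔄)) = 0) (hρ : ρ < a₃)
    (h1 : ∀ b, ‖(A₁ + 𝔄) b‖ ≤ ρ)
    (h2 : ∀ (s : Site P 0) (μ ν : Fin P.d), c * ‖(A₁ + 𝔄) ⟨s.shift ν, μ⟩ - (A₁ + 𝔄) ⟨s, μ⟩‖ ≤ ρ)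
    (N : (PBond P 0 → V) → ℝ) {B : ℝ} (hN : ∀ (f : PBond P 0 → V) (β : ℝ), (∀ b, ‖f b‖ ≤ β) → N (-(G f)) ≤ B * β) :
    N A₁ ≤ B * (C₄ * ρ ^ 2) := by
  have hW := hWq (A₁ + 𝔄) ρ hρ h1 h2
  have hA : A₁ = -(G (W (A₁ + 𝔄))) := eq_neg_of_add_eq_zero_left hsol
  rw [hA]
  exact hN _ _ hW

/-! ## §2 Values in a closed invariant set (reality of the solution) -/

/-- **THE SMALL SOLUTION OF (158) IS `S`-VALUED FOR `S`-VALUED DATA** (p. 296: *«the solution can be constructed as a uniform limit of a sequence of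
successive approximations»* — which stay in any closed invariant value set; print's use: 𝔤-valued data give the 𝔤-valued solution of the
real variational problem inside the 𝔤ᶜ-analytic framework).  Data as in `existsUnique_smallSolution158`; `S ⊆ V` closed with `0 ∈ S`; invariance:
for every `S`-valued `X` of (115)-size `≤ ε₄`, `−G(W(X + 𝔄))` is `S`-valued.  Conclusion: EVERY solution of (158) of (115)-size `≤ ε₄` is
`S`-valued.  Proof: `B11Prop6Scheme.solution_mem_of_invariant` at the jet space over `PBond P 0` (the value condition is closed: evaluation
`JetSup.evalCLM` is continuous) and uniqueness in the ball. [cite: Balaban1985Variational, Prop. 6 pp.295-296, (158) p.302] -/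
theorem smallSolution158_valued [FiniteDimensional ℂ V] {c : ℝ} (hc : 0 < c)
    (G : (PBond P 0 → V) →ₗ[ℂ] (PBond P 0 → V)) (W : (PBond P 0 → V) → (PBond P 0 → V))
    {B₀ C₄ a₃ a ε₄ : ℝ} (hB₀ : 0 ≤ B₀) (hC₄ : 0 ≤ C₄)
    (hG : ∀ (f : PBond P 0 → V) (β : ℝ), (∀ b, ‖f b‖ ≤ β) →
      (∀ b, ‖G f b‖ ≤ B₀ * β) ∧ ∀ (s : Site P 0) (μ ν : Fin P.d), c * ‖G f ⟨s.shift ν, μ⟩ - G f ⟨s, μ⟩‖ ≤ B₀ * β)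
    (hWq : ∀ (Y : PBond P 0 → V) (r : ℝ), r < a₃ → (∀ b, ‖Y b‖ ≤ r) →
      (∀ (s : Site P 0) (μ ν : Fin P.d), c * ‖Y ⟨s.shift ν, μ⟩ - Y ⟨s, μ⟩‖ ≤ r) → ∀ b, ‖W Y b‖ ≤ C₄ * r ^ 2)
    (hWd : DifferentiableOn ℂ W {Y : PBond P 0 → V | (∀ b, ‖Y b‖ < a₃) ∧
      ∀ (s : Site P 0) (μ ν : Fin P.d), c * ‖Y ⟨s.shift ν, μ⟩ - Y ⟨s, μ⟩‖ < a₃})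
    (𝔄 : PBond P 0 → V) (h𝔄 : ∀ b, ‖𝔄 b‖ < a)
    (h𝔄' : ∀ (s : Site P 0) (μ ν : Fin P.d), c * ‖𝔄 ⟨s.shift ν, μ⟩ - 𝔄 ⟨s, μ⟩‖ < a)
    (ha : a ≤ ε₄) (hε₄ : 0 ≤ ε₄) (h2 : 4 * ε₄ ≤ a₃) (h3 : 16 * B₀ * C₄ * ε₄ ≤ 1)
    (S : Set V) (hS : IsClosed S) (h0 : (0 : V) ∈ S)
    (hinv : ∀ X : PBond P 0 → V, (∀ b, X b ∈ S) → (∀ b, ‖X b‖ ≤ ε₄) →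
      (∀ (s : Site P 0) (μ ν : Fin P.d), c * ‖X ⟨s.shift ν, μ⟩ - X ⟨s, μ⟩‖ ≤ ε₄) → ∀ b, -(G (W (X + 𝔄)) b) ∈ S)
    {A₁ : PBond P 0 → V}
    (hA₁ : (∀ b, ‖A₁ b‖ ≤ ε₄) ∧ ∀ (s : Site P 0) (μ ν : Fin P.d), c * ‖A₁ ⟨s.shift ν, μ⟩ - A₁ ⟨s, μ⟩‖ ≤ ε₄)
    (hsol : A₁ + G (W (A₁ + 𝔄)) = 0) : ∀ b, A₁ b ∈ S := by
  classical
  obtain ⟨D, hD⟩ := exists_diffLin P V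
  haveI hw₀ : Fact (∀ i : PBond P 0, 0 < (fun _ : PBond P 0 => (1 : ℝ)) i) := ⟨fun _ => one_pos⟩
  haveI hw₁ : Fact (∀ k : PBond P 0 × Fin P.d, 0 < (fun _ : PBond P 0 × Fin P.d => c) k) := ⟨fun _ => hc⟩
  let w₀ : PBond P 0 → ℝ := fun _ => 1
  let w₁ : PBond P 0 × Fin P.d → ℝ := fun _ => c
  let eY := JetSup.equiv (𝕜 := ℂ) (V := V) w₀ w₁ D
  let eZ := NegSup.equiv w₀ V
  have ha0 : 0 < a := (norm_nonneg _).trans_lt (h𝔄 ⟨default, ⟨0, P.hd⟩⟩)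
  -- pointwise reading of the two norms
  have hYle : ∀ (X : JetSup w₀ w₁ D) (r : ℝ), 0 ≤ r →
      (‖X‖ ≤ r ↔ (∀ b, ‖eY X b‖ ≤ r) ∧
        ∀ (s : Site P 0) (μ ν : Fin P.d), c * ‖eY X ⟨s.shift ν, μ⟩ - eY X ⟨s, μ⟩‖ ≤ r) := by
    intro X r hr
    rw [JetSup.norm_le_iff_pointwise hr]
    refine and_congr (forall_congr' fun b => ?_) ⟨fun h s μ ν => ?_, fun h k => ?_⟩
    · show w₀ b * ‖eY X b‖ ≤ r ↔ ‖eY X b‖ ≤ r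
      rw [show w₀ b = 1 from rfl, one_mul]
    · have := h (⟨s, μ⟩, ν); rwa [hD] at this
    · obtain ⟨b, ν⟩ := k; rw [hD]; exact h b.src b.dir ν
  have hYlt : ∀ (X : JetSup w₀ w₁ D) (r : ℝ), 0 < r →
      (‖X‖ < r ↔ (∀ b, ‖eY X b‖ < r) ∧
        ∀ (s : Site P 0) (μ ν : Fin P.d), c * ‖eY X ⟨s.shift ν, μ⟩ - eY X ⟨s, μ⟩‖ < r) := by
    intro X r hr
    rw [JetSup.norm_lt_iff_pointwise hr]
    refine and_congr (forall_congr' fun b => ?_) ⟨fun h s μ ν => ?_, fun h k => ?_⟩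
    · show w₀ b * ‖eY X b‖ < r ↔ ‖eY X b‖ < r
      rw [show w₀ b = 1 from rfl, one_mul]
    · have := h (⟨s, μ⟩, ν); rwa [hD] at this
    · obtain ⟨b, ν⟩ := k; rw [hD]; exact h b.src b.dir ν
  have hZle : ∀ (f : NegSup w₀ V) (r : ℝ), 0 ≤ r → (‖f‖ ≤ r ↔ ∀ b, ‖eZ f b‖ ≤ r) := by
    intro f r hr
    rw [NegSup.norm_le_iff hr]
    refine forall_congr' fun b => ?_
    show w₀ b * ‖eZ f b‖ ≤ r ↔ ‖eZ f b‖ ≤ r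
    rw [show w₀ b = 1 from rfl, one_mul]
  have hZpt : ∀ (f : NegSup w₀ V) (b : PBond P 0), ‖eZ f b‖ ≤ ‖f‖ := fun f b =>
    ((hZle f ‖f‖ (norm_nonneg _)).1 le_rfl) b
  -- the operator 𝒢 and the map 𝒲 on the normed carriers
  let 𝒢ₗ : NegSup w₀ V →ₗ[ℂ] JetSup w₀ w₁ D :=
    { toFun := fun f => eY.symm (G (eZ f))
      map_add' := fun f g => by
        apply eY.injective; simp only [Equiv.apply_symm_apply, eY, eZ, NegSup.equiv_add, map_add, JetSup.equiv_add]
      map_smul' := fun z f => by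
        apply eY.injective
        simp only [Equiv.apply_symm_apply, eY, eZ, NegSup.equiv_smul, map_smul, JetSup.equiv_smul, RingHom.id_apply] }
  let 𝒢 : NegSup w₀ V →L[ℂ] JetSup w₀ w₁ D := LinearMap.toContinuousLinearMap 𝒢ₗ
  have h𝒢apply : ∀ f, eY (𝒢 f) = G (eZ f) := fun f => rfl
  have h𝒢 : ∀ f, ‖𝒢 f‖ ≤ B₀ * ‖f‖ := by
    intro f
    have hb := hG (eZ f) ‖f‖ (hZpt f)
    rw [hYle _ _ (mul_nonneg hB₀ (norm_nonneg _)), h𝒢apply]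
    exact hb
  let 𝒲 : JetSup w₀ w₁ D → NegSup w₀ V := fun Y => eZ.symm (W (eY Y))
  have h𝒲apply : ∀ Y, eZ (𝒲 Y) = W (eY Y) := fun Y => rfl
  have h𝒲 : QuadAnalytic 𝒲 C₄ a₃ := by
    refine ⟨fun Y hY => ?_, fun Pt Q => ?_⟩
    · have hpt := (hYle Y ‖Y‖ (norm_nonneg _)).1 le_rfl
      have hb := hWq (eY Y) ‖Y‖ hY hpt.1 hpt.2
      rw [hZle _ _ (mul_nonneg hC₄ (sq_nonneg _)), h𝒲apply]
      exact hb
    · have ha₃ : ∀ ζ : ℂ, ‖Pt + ζ • Q‖ < a₃ → 0 < a₃ := fun ζ h => (norm_nonneg _).trans_lt h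
      have hline : Differentiable ℂ (fun ζ : ℂ => eY Pt + ζ • eY Q) :=
        (differentiable_const _).add (differentiable_id.smul_const _)
      have hinto : MapsTo (fun ζ : ℂ => eY Pt + ζ • eY Q) {ζ : ℂ | ‖Pt + ζ • Q‖ < a₃}
          {Y : PBond P 0 → V | (∀ b, ‖Y b‖ < a₃) ∧
            ∀ (s : Site P 0) (μ ν : Fin P.d), c * ‖Y ⟨s.shift ν, μ⟩ - Y ⟨s, μ⟩‖ < a₃} := by
        intro ζ hζ
        exact (hYlt (Pt + ζ • Q) a₃ (ha₃ ζ hζ)).1 hζ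
      have hcomp : DifferentiableOn ℂ (fun ζ : ℂ => W (eY Pt + ζ • eY Q)) {ζ : ℂ | ‖Pt + ζ • Q‖ < a₃} :=
        hWd.comp hline.differentiableOn hinto
      exact (NegSup.continuousLinearEquiv ℂ w₀ (V := V)).symm.differentiable.comp_differentiableOn hcomp
  have h𝔄Y : ‖eY.symm 𝔄‖ < a := by
    rw [hYlt _ _ ha0]
    exact ⟨h𝔄, h𝔄'⟩
  -- the scheme's conditions (domain, self-map, contraction) from `4ε₄ ≤ a₃`, `16B₀C₄ε₄ ≤ 1`, `a ≤ ε₄` — as in `eq158_solution`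
  have hΛ : ∀ Y : JetSup w₀ w₁ D, ‖(0 : JetSup w₀ w₁ D →L[ℂ] JetSup w₀ w₁ D) Y‖ ≤ 0 * ‖Y‖ := fun Y => by simp
  have hJ : ‖(0 : NegSup w₀ V)‖ ≤ 0 := by simp
  have hm : ε₄ + a ≤ 2 * ε₄ := by linarith
  have hm0 : 0 ≤ ε₄ + a := by linarith
  have hdom : 2 * (ε₄ + a) ≤ a₃ := by linarith
  have hself : B₀ * 0 + 0 * (ε₄ + a) + B₀ * C₄ * (ε₄ + a) ^ 2 ≤ ε₄ := by
    have e1 : (ε₄ + a) ^ 2 ≤ (2 * ε₄) ^ 2 := pow_le_pow_left₀ hm0 hm 2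
    have e2 : B₀ * C₄ * (ε₄ + a) ^ 2 ≤ B₀ * C₄ * (2 * ε₄) ^ 2 := mul_le_mul_of_nonneg_left e1 (by positivity)
    have e3 : 16 * B₀ * C₄ * ε₄ * ε₄ ≤ 1 * ε₄ := mul_le_mul_of_nonneg_right h3 hε₄
    nlinarith
  have hcontr : 0 + 4 * B₀ * C₄ * (ε₄ + a) < 1 := by
    have e1 : 4 * B₀ * C₄ * (ε₄ + a) ≤ 4 * B₀ * C₄ * (2 * ε₄) := mul_le_mul_of_nonneg_left hm (by positivity)
    nlinarith
  -- the closed invariant set: `S`-valued jets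
  let S' : Set (JetSup w₀ w₁ D) := ⋂ b : PBond P 0, (JetSup.evalCLM w₀ w₁ D b) ⁻¹' S
  have hmemS' : ∀ X : JetSup w₀ w₁ D, X ∈ S' ↔ ∀ b, eY X b ∈ S := by
    intro X
    simp only [S', Set.mem_iInter, Set.mem_preimage, JetSup.evalCLM_apply]
    exact Iff.rfl
  have hS'closed : IsClosed S' :=
    isClosed_iInter fun b => hS.preimage (JetSup.evalCLM w₀ w₁ D b).continuous
  have h0' : (0 : JetSup w₀ w₁ D) ∈ S' := (hmemS' 0).2 fun _ => h0
  have hcomp : ∀ X : JetSup w₀ w₁ D, eY (-𝒢 (𝒲 (X + eY.symm 𝔄))) = -(G (W (eY X + 𝔄))) := fun X => rfl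
  have hinv' : ∀ X ∈ S', ‖X‖ ≤ ε₄ → mapT 𝒢 0 𝒲 0 (eY.symm 𝔄) X ∈ S' := by
    intro X hX hXn
    rw [mapT_158, hmemS', hcomp]
    have hpt := (hYle X ε₄ hε₄).1 hXn
    exact hinv (eY X) ((hmemS' X).1 hX) hpt.1 hpt.2
  -- the given solution, read in the jet space, is a fixed point in the ball
  have hXn : ‖eY.symm A₁‖ ≤ ε₄ := (hYle _ ε₄ hε₄).2 hA₁
  have hfix : mapT 𝒢 0 𝒲 0 (eY.symm 𝔄) (eY.symm A₁) = eY.symm A₁ := by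
    rw [mapT_158]
    apply eY.injective
    rw [hcomp]
    exact (eq_neg_of_add_eq_zero_left hsol).symm
  have hmem : eY.symm A₁ ∈ S' :=
    solution_mem_of_invariant (J := (0 : NegSup w₀ V)) h𝒢 hΛ h𝒲 hB₀ hC₄ le_rfl hJ h𝔄Y hε₄ hdom hself hcontr S'
      hS'closed h0' hinv' hXn hfix
  exact (hmemS' _).1 hmem

end Generic

/-! ## §3 At the d = 3 carrier (`P := F.P K`, weight `c := L^{K−n}`) -/

section T3

open T3ContinuumYM3Torus (T3Family)

variable {V : Type*} [NormedAddCommGroup V] [NormedSpace ℂ V]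

/-- **THE (165) ENTRY FOR AN ARBITRARY LETTER, d = 3 CARRIER** (fine torus `PBond (F.P K) 0`, `η⁻¹ = L^{K−n}`): `N(−G̃f) ≤ B_N·β` for `|f| ≤ β`
and Prop. 4's (98) pointwise give `N(A₁) ≤ B_N·C₄ρ²` for every solution of (158) with `‖A₁ + HB‖₍₁₁₅₎ ≤ ρ < a₃` — the second-order sizes
`|∂*∂A₁|`, `|ΔA₁|` of (165) included (take `N` = the second-difference letter of pillar F3). [cite: Balaban1985Variational, (165) p.304] -/
theorem letter_solution158_le_T3 (F : T3Family) (n K : ℕ)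
    (G : (PBond (F.P K) 0 → V) →ₗ[ℂ] (PBond (F.P K) 0 → V)) (W : (PBond (F.P K) 0 → V) → (PBond (F.P K) 0 → V))
    {C₄ a₃ ρ : ℝ}
    (hWq : ∀ (Y : PBond (F.P K) 0 → V) (r : ℝ), r < a₃ → (∀ b, ‖Y b‖ ≤ r) →
      (∀ (s : Site (F.P K) 0) (μ ν : Fin 3), (F.L : ℝ) ^ (K - n) * ‖Y ⟨s.shift ν, μ⟩ - Y ⟨s, μ⟩‖ ≤ r) →
        ∀ b, ‖W Y b‖ ≤ C₄ * r ^ 2)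
    {A₁ 𝔄 : PBond (F.P K) 0 → V} (hsol : A₁ + G (W (A₁ + 𝔄)) = 0) (hρ : ρ < a₃)
    (h1 : ∀ b, ‖(A₁ + 𝔄) b‖ ≤ ρ)
    (h2 : ∀ (s : Site (F.P K) 0) (μ ν : Fin 3), (F.L : ℝ) ^ (K - n) * ‖(A₁ + 𝔄) ⟨s.shift ν, μ⟩ - (A₁ + 𝔄) ⟨s, μ⟩‖ ≤ ρ)
    (N : (PBond (F.P K) 0 → V) → ℝ) {B : ℝ}
    (hN : ∀ (f : PBond (F.P K) 0 → V) (β : ℝ), (∀ b, ‖f b‖ ≤ β) → N (-(G f)) ≤ B * β) :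
    N A₁ ≤ B * (C₄ * ρ ^ 2) :=
  letter_solution158_le (P := F.P K) G W hWq hsol hρ h1 h2 N hN

/-- **REALITY OF THE SMALL SOLUTION OF (158) AT THE d = 3 CARRIER**: with the data of `FlatSmallSolution158.existsUnique_smallSolution158_T3`
and a closed value set `S ⊆ V` containing `0` (print: `S = 𝔤 = su(2) ⊂ 𝔤ᶜ`) preserved by `X ↦ −G̃(W(X + HB))` on `S`-valued fields of (115)-size
`≤ ε₄`, every solution of (158) of (115)-size `≤ ε₄` — in particular the unique one — is `S`-valued. [cite: Balaban1985Variational, Prop. 6 pp.295-296, (158) p.302] -/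
theorem smallSolution158_valued_T3 [FiniteDimensional ℂ V] (F : T3Family) (n K : ℕ)
    (G : (PBond (F.P K) 0 → V) →ₗ[ℂ] (PBond (F.P K) 0 → V)) (W : (PBond (F.P K) 0 → V) → (PBond (F.P K) 0 → V))
    {B₀ C₄ a₃ a ε₄ : ℝ} (hB₀ : 0 ≤ B₀) (hC₄ : 0 ≤ C₄)
    (hG : ∀ (f : PBond (F.P K) 0 → V) (β : ℝ), (∀ b, ‖f b‖ ≤ β) →
      (∀ b, ‖G f b‖ ≤ B₀ * β) ∧
        ∀ (s : Site (F.P K) 0) (μ ν : Fin 3), (F.L : ℝ) ^ (K - n) * ‖G f ⟨s.shift ν, μ⟩ - G f ⟨s, μ⟩‖ ≤ B₀ * β)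
    (hWq : ∀ (Y : PBond (F.P K) 0 → V) (r : ℝ), r < a₃ → (∀ b, ‖Y b‖ ≤ r) →
      (∀ (s : Site (F.P K) 0) (μ ν : Fin 3), (F.L : ℝ) ^ (K - n) * ‖Y ⟨s.shift ν, μ⟩ - Y ⟨s, μ⟩‖ ≤ r) →
        ∀ b, ‖W Y b‖ ≤ C₄ * r ^ 2)
    (hWd : DifferentiableOn ℂ W {Y : PBond (F.P K) 0 → V | (∀ b, ‖Y b‖ < a₃) ∧
      ∀ (s : Site (F.P K) 0) (μ ν : Fin 3), (F.L : ℝ) ^ (K - n) * ‖Y ⟨s.shift ν, μ⟩ - Y ⟨s, μ⟩‖ < a₃})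
    (𝔄 : PBond (F.P K) 0 → V) (h𝔄 : ∀ b, ‖𝔄 b‖ < a)
    (h𝔄' : ∀ (s : Site (F.P K) 0) (μ ν : Fin 3), (F.L : ℝ) ^ (K - n) * ‖𝔄 ⟨s.shift ν, μ⟩ - 𝔄 ⟨s, μ⟩‖ < a)
    (ha : a ≤ ε₄) (hε₄ : 0 ≤ ε₄) (h2 : 4 * ε₄ ≤ a₃) (h3 : 16 * B₀ * C₄ * ε₄ ≤ 1)
    (S : Set V) (hS : IsClosed S) (h0 : (0 : V) ∈ S)
    (hinv : ∀ X : PBond (F.P K) 0 → V, (∀ b, X b ∈ S) → (∀ b, ‖X b‖ ≤ ε₄) →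
      (∀ (s : Site (F.P K) 0) (μ ν : Fin 3), (F.L : ℝ) ^ (K - n) * ‖X ⟨s.shift ν, μ⟩ - X ⟨s, μ⟩‖ ≤ ε₄) →
        ∀ b, -(G (W (X + 𝔄)) b) ∈ S)
    {A₁ : PBond (F.P K) 0 → V}
    (hA₁ : (∀ b, ‖A₁ b‖ ≤ ε₄) ∧
      ∀ (s : Site (F.P K) 0) (μ ν : Fin 3), (F.L : ℝ) ^ (K - n) * ‖A₁ ⟨s.shift ν, μ⟩ - A₁ ⟨s, μ⟩‖ ≤ ε₄)
    (hsol : A₁ + G (W (A₁ + 𝔄)) = 0) : ∀ b, A₁ b ∈ S := by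
  have hL : (0 : ℝ) < F.L := by exact_mod_cast lt_trans zero_lt_one F.hL.2
  exact smallSolution158_valued (P := F.P K) (pow_pos hL _) G W hB₀ hC₄ hG hWq hWd 𝔄 h𝔄 h𝔄' ha hε₄ h2 h3 S hS h0 hinv hA₁ hsol

end T3

end Summit.QuantumFields.YangMills.Theorems.FlatSmallSolution158Real

end
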